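import Summits.SmoothPoincare4.SmoothPoincare4.Theses.CommonDualRelay

/-!
# Crux `DualPresentation` (stmt-SmoothPoincare4-15791) — split piece `StabiliseOnce`
# (stmt-SmoothPoincare4-18147, support): birth skeleton `split-stabilise`

Line: one `S²×S²` summand, bookkeeping.  Two registered stubs and the kernel-checked composition
`StabiliseOnce_of : StabiliseOnce` — proved from the two stubs used BY NAME (the only `sorry`s).

* `stub_stabilisedConfiguration` (Wall 1964 JLMS §1, Kervaire–Milnor 1963 §2, Milnor 1965 Def. 3.11):
  the configuration `(A, G, C, P)` of the closed simply connected `N` is transported into a connected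
  sum `N' = N # (S²×S²)` taken at a point off all tubes — transported systems with the same dualities
  and homotopies, the two factor spheres of the new summand as the free framed dual pair `(F, T)`
  disjoint from the rest — and surgery COMMUTES with this stabilisation: whatever `N` surgers to along
  `A` (resp. `C`), `N'` surgers along `A'` (resp. `C'`) to a connected sum of it with `S²×S²`.
* `stub_sphereSumIdentity` (`S⁴ # (S²×S²) ≅ S²×S²`, Kervaire–Milnor 1963 §2 "`Sⁿ` serves as
  identity", with the disc theorem for the independence of the discs): every relational connected sum
  of `S⁴` and `S²×S²` is diffeomorphic to `S²×S²`.
-/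

set_option linter.dupNamespace false

namespace Summit.SmoothPoincare4.SmoothPoincare4.Cruxes.DualPresentation.SplitStabilise

open scoped Manifold ContDiff Topology ContinuousMap
open Literature.Topology.FourManifolds
open Summit.SmoothPoincare4.SmoothPoincare4.Theses.CommonDualRelay

/-- Local notation: the standard spheres. -/
local notation "𝕊⁴" => (Metric.sphere (0 : EuclideanSpace ℝ (Fin 5)) 1)
local notation "𝕊²" => (Metric.sphere (0 : EuclideanSpace ℝ (Fin 3)) 1)

/-- STUB (the stabilised configuration and the commutation of surgery with the stabilisation;
Wall 1964 §1, Kervaire–Milnor 1963 §2, Milnor 1965 Def. 3.11). -/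
theorem stub_stabilisedConfiguration :
    ∀ (N : Type) [TopologicalSpace N] [T2Space N] [SecondCountableTopology N]
      [ChartedSpace (EuclideanSpace ℝ (Fin 4)) N] [IsManifold (𝓡 4) ∞ N] [CompactSpace N]
      [SimplyConnectedSpace N] (oN : SmoothOrientation (𝓡 4) N) (o : SmoothOrientation (𝓡 2) 𝕊²)
      (k : ℕ) (A G C P : FramedSphereFamily (𝓡 4) N (Fin k) 2 2),
      IsGeometricallyDual (𝓡 2) (𝓡 2) (𝓡 4) two_add_two_eq_four o o oN G.sphere A.sphere →
      IsGeometricallyDual (𝓡 2) (𝓡 2) (𝓡 4) two_add_two_eq_four o o oN C.sphere P.sphere →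
      (∀ i, (⟨A.sphere i, A.continuous_sphere i⟩ : C(𝕊², N)).Homotopic ⟨C.sphere i, C.continuous_sphere i⟩) →
      ∃ (N' : Type) (_ : TopologicalSpace N') (_ : T2Space N') (_ : SecondCountableTopology N')
        (_ : ChartedSpace (EuclideanSpace ℝ (Fin 4)) N') (_ : IsManifold (𝓡 4) ∞ N') (_ : CompactSpace N')
        (_ : SimplyConnectedSpace N') (oN' : SmoothOrientation (𝓡 4) N')
        (oS : SmoothOrientation (𝓡 2) 𝕊²) (k' : ℕ) (A' G' C' P' : FramedSphereFamily (𝓡 4) N' (Fin k') 2 2)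
        (F T : FramedSphereFamily (𝓡 4) N' (Fin 1) 2 2),
        IsGeometricallyDual (𝓡 2) (𝓡 2) (𝓡 4) two_add_two_eq_four oS oS oN' G'.sphere A'.sphere ∧
        IsGeometricallyDual (𝓡 2) (𝓡 2) (𝓡 4) two_add_two_eq_four oS oS oN' C'.sphere P'.sphere ∧
        (∀ i, (⟨A'.sphere i, A'.continuous_sphere i⟩ : C(𝕊², N')).Homotopic
          ⟨C'.sphere i, C'.continuous_sphere i⟩) ∧
        IsGeometricallyDual (𝓡 2) (𝓡 2) (𝓡 4) two_add_two_eq_four oS oS oN' F.sphere T.sphere ∧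
        Disjoint (F.cores ∪ T.cores) (A'.cores ∪ G'.cores ∪ C'.cores ∪ P'.cores) ∧
        (∀ (X : Type) [TopologicalSpace X] [T2Space X] [SecondCountableTopology X]
          [ChartedSpace (EuclideanSpace ℝ (Fin 4)) X] [IsManifold (𝓡 4) ∞ X], A.IsSurgery (𝓡 4) X →
          ∃ (P₁ : Type) (_ : TopologicalSpace P₁) (_ : T2Space P₁) (_ : SecondCountableTopology P₁)
            (_ : ChartedSpace (EuclideanSpace ℝ (Fin 4)) P₁) (_ : IsManifold (𝓡 4) ∞ P₁),
            IsConnectedSum (𝓡 4) (𝓡 4) ((𝓡 2).prod (𝓡 2)) X (𝕊² × 𝕊²) P₁ ∧ A'.IsSurgery (𝓡 4) P₁) ∧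
        (∀ (Y : Type) [TopologicalSpace Y] [T2Space Y] [SecondCountableTopology Y]
          [ChartedSpace (EuclideanSpace ℝ (Fin 4)) Y] [IsManifold (𝓡 4) ∞ Y], C.IsSurgery (𝓡 4) Y →
          ∃ (Y' : Type) (_ : TopologicalSpace Y') (_ : T2Space Y') (_ : SecondCountableTopology Y')
            (_ : ChartedSpace (EuclideanSpace ℝ (Fin 4)) Y') (_ : IsManifold (𝓡 4) ∞ Y'),
            IsConnectedSum (𝓡 4) (𝓡 4) ((𝓡 2).prod (𝓡 2)) Y (𝕊² × 𝕊²) Y' ∧ C'.IsSurgery (𝓡 4) Y') := by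
  sorry

/-- STUB (`S⁴ # (S²×S²) ≅ S²×S²` for the relational connected sum; Kervaire–Milnor 1963 §2 with the
disc theorem). -/
theorem stub_sphereSumIdentity :
    ∀ (Y' : Type) [TopologicalSpace Y'] [T2Space Y'] [SecondCountableTopology Y']
      [ChartedSpace (EuclideanSpace ℝ (Fin 4)) Y'] [IsManifold (𝓡 4) ∞ Y'],
      IsConnectedSum (𝓡 4) (𝓡 4) ((𝓡 2).prod (𝓡 2)) 𝕊⁴ (𝕊² × 𝕊²) Y' →
      Nonempty (Y' ≃ₘ⟮𝓡 4, (𝓡 2).prod (𝓡 2)⟯ (𝕊² × 𝕊²)) := by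
  sorry

/-- COMPOSITION (kernel-checked; the only `sorry`s are inside the two declared stubs, used here BY NAME): stabilise the configuration (stub 1), apply its two
commutation clauses to the given surgeries `N ↝ M` along `A` and `N ↝ S⁴` along `C`, and identify the
second result `S⁴ # (S²×S²)` with `S²×S²` (stub 2). -/
theorem StabiliseOnce_of :
    Summit.SmoothPoincare4.SmoothPoincare4.Theses.CommonDualRelay.StabiliseOnce := by
  intro M _ _ _ _ _ N _ _ _ _ _ _ _ oN o k A G C P hGA hCP hAC hA hC
  obtain ⟨N', _, _, _, _, _, _, _, oN', oS, k', A', G', C', P', F, T, hGA', hCP', hAC', hFT, hdisj,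
    hAsurg, hCsurg⟩ := stub_stabilisedConfiguration N oN o k A G C P hGA hCP hAC
  obtain ⟨P₁, _, _, _, _, _, hsum, hA'⟩ := hAsurg M hA
  obtain ⟨Y', _, _, _, _, _, hsumY, hC'⟩ := hCsurg 𝕊⁴ hC
  exact ⟨N', inferInstance, inferInstance, inferInstance, inferInstance, inferInstance, inferInstance,
    inferInstance, oN', oS, k', A', G', C', P', F, T, hGA', hCP', hAC', hFT, hdisj,
    ⟨P₁, inferInstance, inferInstance, inferInstance, inferInstance, inferInstance, hsum, hA'⟩,
    ⟨Y', inferInstance, inferInstance, inferInstance, inferInstance, inferInstance, hC', stub_sphereSumIdentity Y' hsumY⟩⟩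

end Summit.SmoothPoincare4.SmoothPoincare4.Cruxes.DualPresentation.SplitStabilise
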